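import Summits.Ventures.PercRepro.MSTheoremS
import Summits.Ventures.PercRepro.PartnerFlipProj

/-!
# A non-tightening direction of a family

For a family `F` and an element `a`, the two counts `card_eq_card_proj_add_card_partner` and
`card_diffs_eq_card_diffs_proj_add` give `exc(F) − exc(proj a F) = #(a-edges of F \\ F) −
#(a-edges of F)`, where the `a`-edges of a family `M` are the pairs `E, insert a E` of members
(`partner a M`; for `M = F \\ F` this is `diffsX a F ∩ diffsY a F`). Call `a` a
**non-tightening direction** when the two edge counts agree, i.e. `exc(proj a F) = exc(F)`.

**Theorem (NT)** (proofs/MINE1-theoremS.md Addendum 30). At a non-tightening direction `a` with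
nonempty partner family `K = partner a F`:
* `K` is tight and the `a`-edges of `F \\ F` are exactly `K \\ K` (`tight_partner_of_card_eq`);
* with `R = Rstar K` the addable part of `K` (Theorem S: `K \\ K = flip R K`, `R ∈ K`), every member
  `s` avoiding `a` has `s ∩ R ∈ K` and every `t` with `insert a t ∈ F` has `t ∪ R ∈ K`
  (`inter_Rstar_mem_partner`, `union_Rstar_mem_partner`);
* every type-I difference `t \ s` is a difference of two partner members (`diffsY_eq_diffs_partner_of_nonTightening`),
  so `F \\ F` is closed under removing `a` (`erase_mem_diffs_of_mem_diffs`);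
* for every `b ≠ a`, neither `F` nor `F \\ F` has a pure `{a, b}`-diagonal
  (`insert_mem_or_insert_mem_of_mem_of_insert_insert_mem`, `mem_or_insert_insert_mem_of_insert_mem`
  and their `_diffs` twins), and the full `{a, b}`-squares of `F \\ F` and of `F` are equinumerous
  (`card_partner_partner_diffs_eq`);
* **consequently `exc(proj b (proj a F)) = exc(proj b F)` for every `b`**
  (`card_partner_proj_diffs_eq`, `card_diffs_proj_proj_add_eq`, `tight_proj_proj_iff`): removing a
  non-tightening direction never changes the excess of any further projection — the lifting lemma
  `tight_proj_of_tight_proj_proj` behind Theorem (TT) (ExcessOneTwoTightTraces.lean).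
-/

namespace PercRepro.MSTight

open Finset
open scoped FinsetFamily symmDiff

variable {α : Type*} [DecidableEq α]

section NonTightening

variable [Fintype α] {a : α} {F : Finset (Finset α)}

omit [Fintype α] in
/-- **(1)** If the `a`-edge counts of `F \\ F` and `F` agree, the partner family is tight and its
differences are exactly the `a`-edges of `F \\ F`. -/
theorem tight_partner_of_card_eq (hε : (diffsX a F ∩ diffsY a F).card = (partner a F).card) :
    Tight (partner a F) ∧ diffsX a F ∩ diffsY a F = partner a F \\ partner a F := by
  have h1 := diffs_partner_subset a F
  have h2 : (partner a F).card ≤ (partner a F \\ partner a F).card := card_le_card_diffs _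
  have h3 := card_le_card h1
  refine ⟨?_, (eq_of_subset_of_card_le h1 (by omega)).symm⟩
  unfold Tight
  omega

/-- The `a`-edges of `F \\ F` are the flip of the partner family along its addable part. -/
theorem diffsX_inter_diffsY_eq_flip (hε : (diffsX a F ∩ diffsY a F).card = (partner a F).card) :
    diffsX a F ∩ diffsY a F = flip (Rstar (partner a F)) (partner a F) := by
  rw [(tight_partner_of_card_eq hε).2, diffs_eq_flip_of_tight (tight_partner_of_card_eq hε).1]

/-- The addable part of a nonempty partner family is a partner member. -/
theorem Rstar_partner_mem (hε : (diffsX a F ∩ diffsY a F).card = (partner a F).card)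
    (hK : (partner a F).Nonempty) : Rstar (partner a F) ∈ partner a F :=
  Rstar_mem_of_dichotomy (dichotomy_of_tight (tight_partner_of_card_eq hε).1) hK

/-- The addable part of a nonempty partner family avoids `a`. -/
theorem notMem_Rstar_partner (hε : (diffsX a F ∩ diffsY a F).card = (partner a F).card)
    (hK : (partner a F).Nonempty) : a ∉ Rstar (partner a F) :=
  not_mem_of_mem_partner (Rstar_partner_mem hε hK)

/-- **(2a)** Every member avoiding `a` meets the addable part in a partner member. -/
theorem inter_Rstar_mem_partner (hε : (diffsX a F ∩ diffsY a F).card = (partner a F).card)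
    (hK : (partner a F).Nonempty) {s : Finset α} (hs : s ∈ part0 a F) :
    s ∩ Rstar (partner a F) ∈ partner a F := by
  set R := Rstar (partner a F) with hR
  have hRK : R ∈ partner a F := Rstar_partner_mem hε hK
  have haR : a ∉ R := not_mem_of_mem_partner hRK
  obtain ⟨hsF, has⟩ := mem_part0.1 hs
  -- `R \ s` and `insert a (R \ s) = insert a R \ s` are differences
  have h1 : R \ s ∈ F \\ F := mem_diffs.2 ⟨R, mem_of_mem_partner hRK, s, hsF, rfl⟩
  have h2 : insert a (R \ s) ∈ F \\ F := by
    refine mem_diffs.2 ⟨insert a R, insert_mem_of_mem_partner hRK, s, hsF, ?_⟩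
    rw [insert_sdiff_of_notMem _ has]
  have h3 : R \ s ∈ diffsX a F ∩ diffsY a F := by
    refine mem_inter.2 ⟨mem_diffsX_iff.2 ⟨h1, ?_⟩, mem_diffsY_iff.2 ⟨?_, h2⟩⟩ <;>
      simp [haR]
  rw [diffsX_inter_diffsY_eq_flip hε] at h3
  obtain ⟨k, hk, hkR⟩ := mem_flip.1 h3
  have e : k = s ∩ R := by
    ext x
    have hx := Finset.ext_iff.1 hkR x
    simp only [mem_symmDiff, mem_sdiff, mem_inter] at hx ⊢
    tauto
  rwa [e] at hk

/-- **(2b)** Every member containing `a`, minus `a`, joins the addable part to a partner member. -/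
theorem union_Rstar_mem_partner (hε : (diffsX a F ∩ diffsY a F).card = (partner a F).card)
    (hK : (partner a F).Nonempty) {t : Finset α} (ht : t ∈ partr a F) :
    t ∪ Rstar (partner a F) ∈ partner a F := by
  set R := Rstar (partner a F) with hR
  have hRK : R ∈ partner a F := Rstar_partner_mem hε hK
  have haR : a ∉ R := not_mem_of_mem_partner hRK
  obtain ⟨hat, htF⟩ := mem_partr.1 ht
  have h1 : t \ R ∈ F \\ F := by
    refine mem_diffs.2 ⟨insert a t, htF, insert a R, insert_mem_of_mem_partner hRK, ?_⟩
    rw [insert_sdiff_insert, sdiff_insert_of_notMem hat]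
  have h2 : insert a (t \ R) ∈ F \\ F := by
    refine mem_diffs.2 ⟨insert a t, htF, R, mem_of_mem_partner hRK, ?_⟩
    rw [insert_sdiff_of_notMem _ haR]
  have h3 : t \ R ∈ diffsX a F ∩ diffsY a F := by
    refine mem_inter.2 ⟨mem_diffsX_iff.2 ⟨h1, ?_⟩, mem_diffsY_iff.2 ⟨?_, h2⟩⟩ <;>
      simp [hat]
  rw [diffsX_inter_diffsY_eq_flip hε] at h3
  obtain ⟨k, hk, hkR⟩ := mem_flip.1 h3
  have e : k = t ∪ R := by
    ext x
    have hx := Finset.ext_iff.1 hkR x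
    simp only [mem_symmDiff, mem_sdiff, mem_union] at hx ⊢
    tauto
  rwa [e] at hk

/-- **(3)** Every type-I difference `t \ s` (`insert a t ∈ F`, `s ∈ F`, `a ∉ s`) is a difference of
two partner members: `t \ s = (t \ (s ∩ R)) ∩ ((t ∪ R) \ s)`, both factors are `a`-edges of
`F \\ F`, i.e. members of the flip, whose intersection is a twin-closed subset of a flip member. -/
theorem sdiff_mem_diffs_partner_of_partr_of_part0
    (hε : (diffsX a F ∩ diffsY a F).card = (partner a F).card)
    (hK : (partner a F).Nonempty) {t s : Finset α} (ht : t ∈ partr a F) (hs : s ∈ part0 a F) :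
    t \ s ∈ partner a F \\ partner a F := by
  set R := Rstar (partner a F) with hR
  have hT := (tight_partner_of_card_eq hε).1
  have hdich := dichotomy_of_tight hT
  have haR : a ∉ R := notMem_Rstar_partner hε hK
  obtain ⟨hat, htF⟩ := mem_partr.1 ht
  obtain ⟨hsF, has⟩ := mem_part0.1 hs
  have hsR : s ∩ R ∈ partner a F := inter_Rstar_mem_partner hε hK hs
  have htR : t ∪ R ∈ partner a F := union_Rstar_mem_partner hε hK ht
  have hflip := diffsX_inter_diffsY_eq_flip hε
  -- first factor
  have hW₁ : t \ (s ∩ R) ∈ flip R (partner a F) := by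
    rw [← hflip]
    have h1 : t \ (s ∩ R) ∈ F \\ F := by
      refine mem_diffs.2 ⟨insert a t, htF, insert a (s ∩ R), insert_mem_of_mem_partner hsR, ?_⟩
      rw [insert_sdiff_insert, sdiff_insert_of_notMem hat]
    have h2 : insert a (t \ (s ∩ R)) ∈ F \\ F := by
      refine mem_diffs.2 ⟨insert a t, htF, s ∩ R, mem_of_mem_partner hsR, ?_⟩
      rw [insert_sdiff_of_notMem _ (fun h => has (mem_inter.1 h).1)]
    refine mem_inter.2 ⟨mem_diffsX_iff.2 ⟨h1, ?_⟩, mem_diffsY_iff.2 ⟨?_, h2⟩⟩ <;> simp [hat]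
  -- second factor
  have hW₂ : (t ∪ R) \ s ∈ flip R (partner a F) := by
    rw [← hflip]
    have h1 : (t ∪ R) \ s ∈ F \\ F := mem_diffs.2 ⟨t ∪ R, mem_of_mem_partner htR, s, hsF, rfl⟩
    have h2 : insert a ((t ∪ R) \ s) ∈ F \\ F := by
      refine mem_diffs.2 ⟨insert a (t ∪ R), insert_mem_of_mem_partner htR, s, hsF, ?_⟩
      rw [insert_sdiff_of_notMem _ has]
    refine mem_inter.2 ⟨mem_diffsX_iff.2 ⟨h1, ?_⟩, mem_diffsY_iff.2 ⟨?_, h2⟩⟩ <;>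
      simp [hat, haR]
  have e : t \ s = (t \ (s ∩ R)) ∩ ((t ∪ R) \ s) := by
    ext x
    simp only [mem_sdiff, mem_inter, mem_union]
    tauto
  rw [diffs_eq_flip_of_tight hT, e]
  exact mem_flip_of_subset_of_twinClosed hdich hW₁ inter_subset_left
    ((twinClosed_of_mem_flip hW₁).inter (twinClosed_of_mem_flip hW₂))

/-- **(3)** At a non-tightening direction with a nonempty partner family, `Y = K \\ K`. -/
theorem diffsY_eq_diffs_partner_of_nonTightening (hε : (diffsX a F ∩ diffsY a F).card = (partner a F).card)
    (hK : (partner a F).Nonempty) : diffsY a F = partner a F \\ partner a F := by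
  refine Subset.antisymm ?_ ?_
  · intro E hE
    obtain ⟨t, ht, s, hs, rfl⟩ := mem_diffs.1 hE
    exact sdiff_mem_diffs_partner_of_partr_of_part0 hε hK ht hs
  · intro E hE
    exact (mem_inter.1 (diffs_partner_subset a F hE)).2

/-- **(3′)** At a non-tightening direction with a nonempty partner family the difference family is
closed under removing `a`. -/
theorem erase_mem_diffs_of_mem_diffs (hε : (diffsX a F ∩ diffsY a F).card = (partner a F).card)
    (hK : (partner a F).Nonempty) {d : Finset α} (hd : d ∈ F \\ F) : d.erase a ∈ F \\ F := by
  by_cases had : a ∈ d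
  · have h1 : d.erase a ∈ diffsY a F :=
      mem_diffsY_iff.2 ⟨notMem_erase a d, by rwa [insert_erase had]⟩
    rw [diffsY_eq_diffs_partner_of_nonTightening hε hK] at h1
    exact diffs_mono_self (fun k hk => mem_of_mem_partner hk) h1
  · rwa [erase_eq_of_notMem had]

/-- **(4, type I)** No pure `{a, b}`-diagonal in `F`: if `E` and `insert a (insert b E)` are members
then so is `insert a E` or `insert b E`. -/
theorem insert_mem_or_insert_mem_of_mem_of_insert_insert_mem
    (hε : (diffsX a F ∩ diffsY a F).card = (partner a F).card) (hK : (partner a F).Nonempty)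
    {b : α} (hba : b ≠ a) {E : Finset α} (haE : a ∉ E) (hbE : b ∉ E) (hE : E ∈ F)
    (hEab : insert a (insert b E) ∈ F) : insert a E ∈ F ∨ insert b E ∈ F := by
  set R := Rstar (partner a F) with hR
  have hT := (tight_partner_of_card_eq hε).1
  have hdich := dichotomy_of_tight hT
  have h1 : E ∩ R ∈ partner a F := inter_Rstar_mem_partner hε hK (mem_part0.2 ⟨hE, haE⟩)
  have h2 : insert b E ∪ R ∈ partner a F :=
    union_Rstar_mem_partner hε hK (mem_partr.2 ⟨by simp [haE, hba.symm], hEab⟩)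
  have hW : (E ∩ R) ∆ R ∈ flip R (partner a F) := symmDiff_mem_flip h1
  have hV : (insert b E ∪ R) ∆ R ∈ flip R (partner a F) := symmDiff_mem_flip h2
  have hU := union_mem_flip_of_dichotomy hdich hT hW hV
  by_cases hbR : b ∈ R
  · left
    have e : (E ∩ R) ∆ R ∩ R ∪ (insert b E ∪ R) ∆ R \ R = E ∆ R := by
      ext x
      simp only [mem_union, mem_inter, mem_sdiff, mem_symmDiff, mem_insert]
      by_cases hx : x = b
      · subst hx
        simp [hbR, hbE]
      · simp only [hx, false_or]
        tauto
    rw [e] at hU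
    exact insert_mem_of_mem_partner (mem_of_symmDiff_mem_flip hU)
  · right
    have e : (E ∩ R) ∆ R ∩ R ∪ (insert b E ∪ R) ∆ R \ R = insert b E ∆ R := by
      ext x
      simp only [mem_union, mem_inter, mem_sdiff, mem_symmDiff, mem_insert]
      by_cases hx : x = b
      · subst hx
        simp [hbR, hbE]
      · simp only [hx, false_or]
        tauto
    rw [e] at hU
    exact mem_of_mem_partner (mem_of_symmDiff_mem_flip hU)

/-- **(4, type II)** No pure `{a, b}`-diagonal in `F`: if `insert a E` and `insert b E` are members
then so is `E` or `insert a (insert b E)`. -/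
theorem mem_or_insert_insert_mem_of_insert_mem_of_insert_mem
    (hε : (diffsX a F ∩ diffsY a F).card = (partner a F).card) (hK : (partner a F).Nonempty)
    {b : α} (hba : b ≠ a) {E : Finset α} (haE : a ∉ E) (hbE : b ∉ E) (hEa : insert a E ∈ F)
    (hEb : insert b E ∈ F) : E ∈ F ∨ insert a (insert b E) ∈ F := by
  set R := Rstar (partner a F) with hR
  have hT := (tight_partner_of_card_eq hε).1
  have hdich := dichotomy_of_tight hT
  have h1 : E ∪ R ∈ partner a F := union_Rstar_mem_partner hε hK (mem_partr.2 ⟨haE, hEa⟩)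
  have h2 : insert b E ∩ R ∈ partner a F :=
    inter_Rstar_mem_partner hε hK (mem_part0.2 ⟨hEb, by simp [haE, hba.symm]⟩)
  have hW : (insert b E ∩ R) ∆ R ∈ flip R (partner a F) := symmDiff_mem_flip h2
  have hV : (E ∪ R) ∆ R ∈ flip R (partner a F) := symmDiff_mem_flip h1
  have hU := union_mem_flip_of_dichotomy hdich hT hW hV
  by_cases hbR : b ∈ R
  · right
    have e : (insert b E ∩ R) ∆ R ∩ R ∪ (E ∪ R) ∆ R \ R = insert b E ∆ R := by
      ext x
      simp only [mem_union, mem_inter, mem_sdiff, mem_symmDiff, mem_insert]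
      by_cases hx : x = b
      · subst hx
        simp [hbR, hbE]
      · simp only [hx, false_or]
        tauto
    rw [e] at hU
    exact insert_mem_of_mem_partner (mem_of_symmDiff_mem_flip hU)
  · left
    have e : (insert b E ∩ R) ∆ R ∩ R ∪ (E ∪ R) ∆ R \ R = E ∆ R := by
      ext x
      simp only [mem_union, mem_inter, mem_sdiff, mem_symmDiff, mem_insert]
      by_cases hx : x = b
      · subst hx
        simp [hbR, hbE]
      · simp only [hx, false_or]
        tauto
    rw [e] at hU
    exact mem_of_mem_partner (mem_of_symmDiff_mem_flip hU)

/-- **(5, type I)** No pure `{a, b}`-diagonal in `F \\ F`. -/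
theorem insert_mem_or_insert_mem_of_mem_of_insert_insert_mem_diffs
    (hε : (diffsX a F ∩ diffsY a F).card = (partner a F).card) (hK : (partner a F).Nonempty)
    {b : α} (hba : b ≠ a) {E : Finset α} (haE : a ∉ E)
    (hEab : insert a (insert b E) ∈ F \\ F) :
    insert a E ∈ F \\ F ∨ insert b E ∈ F \\ F := by
  right
  have h := erase_mem_diffs_of_mem_diffs hε hK hEab
  rwa [erase_insert (by simp [haE, hba.symm])] at h

/-- **(5, type II)** No pure `{a, b}`-diagonal in `F \\ F`. -/
theorem mem_or_insert_insert_mem_of_insert_mem_diffs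
    (hε : (diffsX a F ∩ diffsY a F).card = (partner a F).card) (hK : (partner a F).Nonempty)
    {E : Finset α} (haE : a ∉ E) (hEa : insert a E ∈ F \\ F) : E ∈ F \\ F := by
  have h := erase_mem_diffs_of_mem_diffs hε hK hEa
  rwa [erase_insert haE] at h

end NonTightening

section Main

variable [Fintype α] {a : α} {F : Finset (Finset α)}

/-- **(6)** At a non-tightening direction with a nonempty partner family the full `{a, b}`-squares of
`F \\ F` and of `F` are equinumerous. -/
theorem card_partner_partner_diffs_eq (hε : (diffsX a F ∩ diffsY a F).card = (partner a F).card)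
    (b : α) : (partner b (partner a (F \\ F))).card = (partner b (partner a F)).card := by
  rw [← diffsX_inter_diffsY_eq_partner_diffs, diffsX_inter_diffsY_eq_flip hε, card_partner_flip]

/-- **(7)** At a non-tightening direction `a` with a nonempty partner family, for every `b ≠ a` the
`a`-edges of `proj b (F \\ F)` and of `proj b F` are equinumerous. -/
theorem card_partner_proj_diffs_eq (hε : (diffsX a F ∩ diffsY a F).card = (partner a F).card)
    (hK : (partner a F).Nonempty) {b : α} (hba : b ≠ a) :
    (partner a (proj b (F \\ F))).card = (partner a (proj b F)).card := by
  have hD := partner_proj_eq_proj_partner (M := F \\ F) hba.symm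
    (fun E haE _ _ hEab =>
      insert_mem_or_insert_mem_of_mem_of_insert_insert_mem_diffs hε hK hba haE hEab)
    (fun E haE _ hEa _ => Or.inl (mem_or_insert_insert_mem_of_insert_mem_diffs hε hK haE hEa))
  have hF := partner_proj_eq_proj_partner (M := F) hba.symm
    (fun E haE hbE hE hEab =>
      insert_mem_or_insert_mem_of_mem_of_insert_insert_mem hε hK hba haE hbE hE hEab)
    (fun E haE hbE hEa hEb =>
      mem_or_insert_insert_mem_of_insert_mem_of_insert_mem hε hK hba haE hbE hEa hEb)
  have c1 := card_eq_card_proj_add_card_partner b (partner a (F \\ F))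
  have c2 := card_eq_card_proj_add_card_partner b (partner a F)
  have c3 : (partner a (F \\ F)).card = (partner a F).card := by
    rw [← diffsX_inter_diffsY_eq_partner_diffs]; exact hε
  have c4 := card_partner_partner_diffs_eq hε b
  rw [hD, hF]
  omega

/-- **(7′)** Removing a non-tightening direction `a` (with a nonempty partner family) does not change
the excess of the projection along any `b ≠ a`:
`|D(proj a (proj b F))| + |proj b F| = |D(proj b F)| + |proj a (proj b F)|`. -/
theorem card_diffs_proj_proj_add_eq (hε : (diffsX a F ∩ diffsY a F).card = (partner a F).card)
    (hK : (partner a F).Nonempty) {b : α} (hba : b ≠ a) :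
    (proj a (proj b F) \\ proj a (proj b F)).card + (proj b F).card =
      (proj b F \\ proj b F).card + (proj a (proj b F)).card := by
  have h1 := card_diffs_eq_card_diffs_proj_add a (proj b F)
  have h2 := card_eq_card_proj_add_card_partner a (proj b F)
  have h3 : diffsX a (proj b F) ∩ diffsY a (proj b F) = partner a (proj b (F \\ F)) := by
    rw [diffsX_inter_diffsY_eq_partner_diffs, diffs_proj_eq_proj_diffs]
  have h4 := card_partner_proj_diffs_eq hε hK hba
  rw [h3, h4] at h1
  omega

/-- **The lifting lemma.** If `a` is a non-tightening direction with a nonempty partner family and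
`proj b (proj a F)` is tight, then `proj b F` is tight. -/
theorem tight_proj_of_tight_proj_proj (hε : (diffsX a F ∩ diffsY a F).card = (partner a F).card)
    (hK : (partner a F).Nonempty) {b : α} (hba : b ≠ a) (hT : Tight (proj b (proj a F))) :
    Tight (proj b F) := by
  have h := card_diffs_proj_proj_add_eq hε hK hba
  rw [← proj_proj_comm] at hT
  unfold Tight at hT ⊢
  omega

/-- **The tight-trace set is inherited exactly.** At a non-tightening direction `a` with a nonempty
partner family, `proj b (proj a F)` is tight iff `proj b F` is, for every `b ≠ a`. -/
theorem tight_proj_proj_iff (hε : (diffsX a F ∩ diffsY a F).card = (partner a F).card)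
    (hK : (partner a F).Nonempty) {b : α} (hba : b ≠ a) :
    Tight (proj b (proj a F)) ↔ Tight (proj b F) := by
  have h := card_diffs_proj_proj_add_eq hε hK hba
  rw [← proj_proj_comm]
  unfold Tight
  omega

end Main

end PercRepro.MSTight
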